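import Summits.BirchSwinnertonDyer.BirchSwinnertonDyer.Theorems.SignedBaseChangeAnticyclotomicEisensteinDivisibilitySpecializationCyclic
import Literature.NumberTheory.IwasawaTheory.IwasawaAlgebraTwoVarRegularProofs
import Summits.BirchSwinnertonDyer.Rank1Residual.X11b.FittingCongruenceLimit
import Mathlib.RingTheory.Ideal.AssociatedPrime.Finiteness
import HarnessLib

/-!
# Specialisation `X ↦ 0` of characteristic ideals: the Herbrand formula over `A⟦X⟧` and the case
# `Λ₂ = ℤ_p⟦T₂⟧⟦T₁⟧ → Λ₁ = ℤ_p⟦T₂⟧` (proofs)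

Helper file (--supports stmt-BirchSwinnertonDyer-20727); third file on the specialisation of `Module.charIdeal` along
`π = constantCoeff : A⟦X⟧ → A` (after `…SpecializationLengthProofs`, `…SpecializationCyclicProofs`).
PROVED here, for `A` a Noetherian domain with `A⟦X⟧` factorial (and `A` factorial for the global form):

* `PowerSeriesSpecialization.lengthAt_quotSMulTop_eq_add` — **local Herbrand formula**: for a finitely
  generated `A⟦X⟧`-module `N` killed by some `s` with `s(0) ≠ 0` (⟺ torsion with `N_{(X)} = 0`) and any
  compatible `A`-structure, at every height-one prime `𝔮` of `A`:
  `ℓ_𝔮(N/XN) = ℓ_𝔮(N[X]) + ℓ_𝔮(A/char_{A⟦X⟧}(N)(0))`. Dévissage over a prime filtration of `N` (Mathlib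
  `IsNoetherianRing.induction_on_isQuotientEquivQuotientPrime`; the motive quantifies over the
  compatible `A`-structures): additivity by the snake (`Module.lengthAt_smul_snake`) and by
  `lengthAt_quotient_map_charIdeal_eq_add`, cyclic modules by `lengthAt_cyclic`;
* `PowerSeriesSpecialization.charIdeal_quotSMulTop_eq_mul` — **global Herbrand formula**
  `ch_A(N/XN) = ch_A(N[X]) · ch_{A⟦X⟧}(N)(0)`, and `charIdeal_quotSMulTop_eq_map` — the case `N[X] = 0`:
  `ch_A(N/XN) = ch_{A⟦X⟧}(N)(0)`; `exists_constantCoeff_ne_zero_smul_eq_zero` converts the hypothesis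
  "`N/XN` is `A`-torsion" (determinant trick);
* `TwoVar.map_constantCoeff_charIdeal_eq` (+ `_of_isTorsion`) — the case `A = Λ₁ = ℤ_p⟦T⟧`,
  `A⟦X⟧ = Λ₂` (factorial: Mathlib for `Λ₁`; tree
  `IwasawaTheory.uniqueFactorizationMonoid_iwasawaAlgebraTwoVar` for `Λ₂`, Auslander–Buchsbaum):
  **`π(ch_{Λ₂} M) = ch_{Λ₁}(M/T₁M)`** for `M` f.g. torsion, `T₁` injective on `M`, `M/T₁M` torsion,
  with the `Λ₁`-structure on `M/T₁M` RESTRICTED ALONG THE CONSTANTS `PowerSeries.C : Λ₁ → Λ₂` (written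
  `letI := Module.compHom _ PowerSeries.C` into the statement). This is the algebra printed as Delbourgo,
  *Elliptic Curves and Big Galois Representations* (2008), Ch. X Lemma 10.5 (case `r = 0`, `M[Y] = 0`),
  Ochiai, Compos. Math. 142 (2006) Lemma 7.2, Skinner–Urban, Invent. Math. 195 (2014) Cor. 3.2.9 (ii).

CAVEAT on the tree's named fact `IwasawaAlgebra.Delbourgo2008_lemma_10_5_specialization`
(`IwasawaAlgebraSpecialization.lean`): its binder `[IsScalarTower (IwasawaAlgebra p) (PowerSeries
(IwasawaAlgebra p)) M]` elaborates to Mathlib's default `PowerSeries.algebraPowerSeries : Algebra Λ₁ Λ₂`,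
the map `T ↦ T₁` (NOT the constants), under which the typed equality is false
(`SignedBaseChangeAnticyclotomicEisensteinDivisibilitySpecializationFactCounterexample.lean`); the theorems here are the intended statement and
do not use that fact.

Written for the lead-prover seat of crux `AnticyclotomicEisensteinDivisibility`
(stmt-BirchSwinnertonDyer-20727, route SignedBaseChange; stub S2 = control + this specialisation +
`X_Gr₂[T₁] = 0`). Nothing about elliptic curves is asserted.

## References

* D. Delbourgo, *Elliptic Curves and Big Galois Representations*, LMS LNS 356, CUP 2008, Ch. X,
  Lemma 10.5. [Delbourgo2008]
* T. Ochiai, *On the two-variable Iwasawa main conjecture*, Compos. Math. 142 (2006), Lemma 7.2.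
* C. Skinner, E. Urban, *The Iwasawa main conjectures for GL₂*, Invent. Math. 195 (2014), §3.1.6,
  Cor. 3.2.9. [SkinnerUrban2013]
* N. Bourbaki, *Algèbre commutative*, Ch. VII §4.4–4.5.
-/

noncomputable section

open Function
open scoped Pointwise

-- D-0017: single-problem summit, the namespace repeats the problem name by design.
set_option linter.dupNamespace false
set_option autoImplicit false

namespace Summit.BirchSwinnertonDyer.BirchSwinnertonDyer.Theorems.SignedBaseChangeAcDivSpecialization

open Literature.NumberTheory.EllipticCurves Literature.NumberTheory.EllipticCurves.Module

namespace PowerSeriesSpecialization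

open LocalLength PowerSeries

universe u v

variable {A : Type u} [CommRing A]

/-! ### Dévissage: the local Herbrand formula -/

section Devissage

variable [IsDomain A] [IsNoetherianRing A] [UniqueFactorizationMonoid (PowerSeries A)]

/-- **Local Herbrand formula for `X ↦ 0`.** Let `A` be a Noetherian domain with `A⟦X⟧` factorial,
and `N` a finitely generated `A⟦X⟧`-module killed by some `s` with `s(0) ≠ 0` (equivalently: `N` is
torsion and `N_{(X)} = 0`), with any compatible `A`-structure. Then for every height-one prime `𝔮`
of `A`, `ℓ_𝔮(N/XN) = ℓ_𝔮(N[X]) + ℓ_𝔮(A/char_{A⟦X⟧}(N)(0))`, where `char(N)(0)` is the image of the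
(principal) characteristic ideal under `X ↦ 0`. Proof by dévissage over a prime filtration of `N`
(Mathlib `IsNoetherianRing.induction_on_isQuotientEquivQuotientPrime`): the Herbrand-type quantity
`ℓ_𝔮(·/X·) − ℓ_𝔮(·[X])` is additive by the snake lemma (`lengthAt_smul_snake`), so is
`ℓ_𝔮(A/char(·)(0))` (`lengthAt_quotient_map_charIdeal_eq_add`), and the cyclic modules are
`lengthAt_cyclic` (Bourbaki AC VII §4.5; the one-variable case `A = ℤ_p` is the `Γ`-Euler
characteristic formula, Greenberg LNM 1716 §4). [folklore] -/
theorem lengthAt_quotSMulTop_eq_add (N : Type v) [AddCommGroup N] [Module (PowerSeries A) N]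
    (hfin : Module.Finite (PowerSeries A) N) :
    ∀ [Module A N] [IsScalarTower A (PowerSeries A) N],
      (∃ s : PowerSeries A, PowerSeries.constantCoeff s ≠ 0 ∧ ∀ m : N, s • m = 0) →
      ∀ 𝔮 : PrimeSpectrum A, 𝔮.asIdeal.height = 1 →
        lengthAt A (QuotSMulTop (X : PowerSeries A) N) 𝔮 =
          lengthAt A (Submodule.torsionBy (PowerSeries A) N (X : PowerSeries A)) 𝔮 +
            lengthAt A (A ⧸ (charIdeal (PowerSeries A) N).map
              (PowerSeries.constantCoeff (R := A))) 𝔮 := by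
  refine IsNoetherianRing.induction_on_isQuotientEquivQuotientPrime (A := PowerSeries A) hfin
    (motive := fun N _ _ _ => ∀ [Module A N] [IsScalarTower A (PowerSeries A) N],
      (∃ s : PowerSeries A, PowerSeries.constantCoeff s ≠ 0 ∧ ∀ m : N, s • m = 0) →
      ∀ 𝔮 : PrimeSpectrum A, 𝔮.asIdeal.height = 1 →
        lengthAt A (QuotSMulTop (X : PowerSeries A) N) 𝔮 =
          lengthAt A (Submodule.torsionBy (PowerSeries A) N (X : PowerSeries A)) 𝔮 +
            lengthAt A (A ⧸ (charIdeal (PowerSeries A) N).map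
              (PowerSeries.constantCoeff (R := A))) 𝔮) ?_ ?_ ?_
  · -- the zero module
    intro N _ _ _ _ _ _ _ 𝔮 _
    haveI : Subsingleton (QuotSMulTop (X : PowerSeries A) N) :=
      (Submodule.mkQ_surjective _).subsingleton
    rw [lengthAt_eq_zero_of_subsingleton, lengthAt_eq_zero_of_subsingleton,
      charIdeal_eq_one_of_subsingleton, Ideal.one_eq_top, Ideal.map_top, lengthAt_quotient_top,
      zero_add]
  · -- cyclic modules `N ≃ A⟦X⟧/𝔭`
    intro N _ _ _ 𝔭 e _ _ hs 𝔮 h𝔮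
    obtain ⟨s, hs0, hs⟩ := hs
    have hsmem : s ∈ 𝔭.asIdeal := by
      have h1 : s • (Ideal.Quotient.mk 𝔭.asIdeal 1) = 0 := by
        have := congrArg e (hs (e.symm (Ideal.Quotient.mk 𝔭.asIdeal 1)))
        rwa [LinearEquiv.map_smul, LinearEquiv.apply_symm_apply, map_zero] at this
      change Ideal.Quotient.mk 𝔭.asIdeal (s * 1) = 0 at h1
      rwa [mul_one, Ideal.Quotient.eq_zero_iff_mem] at h1
    have h0 : 𝔭.asIdeal ≠ ⊥ := fun h => hs0 (by
      rw [h, Ideal.mem_bot] at hsmem; rw [hsmem, map_zero])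
    have hX : 𝔭.asIdeal ≠ Ideal.span {(X : PowerSeries A)} := fun h =>
      hs0 (mem_span_X_iff.mp (h ▸ hsmem))
    have h1 : lengthAt A (QuotSMulTop (X : PowerSeries A) N) 𝔮 =
        lengthAt A (QuotSMulTop (X : PowerSeries A) (PowerSeries A ⧸ 𝔭.asIdeal)) 𝔮 :=
      lengthAt_eq_of_linearEquiv ((QuotSMulTop.congr (X : PowerSeries A) e).restrictScalars A) 𝔮
    have h2 : lengthAt A (Submodule.torsionBy (PowerSeries A) N (X : PowerSeries A)) 𝔮 =
        lengthAt A (Submodule.torsionBy (PowerSeries A) (PowerSeries A ⧸ 𝔭.asIdeal)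
          (X : PowerSeries A)) 𝔮 :=
      le_antisymm
        (lengthAt_le_of_injective
          ((e.toLinearMap.restrict (Literature.RingTheory.Length.mapsTo_torsionBy (X : PowerSeries A)
            e.toLinearMap)).restrictScalars A)
          (Literature.RingTheory.Length.restrict_torsionBy_injective _ _ e.injective) 𝔮)
        (lengthAt_le_of_injective
          ((e.symm.toLinearMap.restrict (Literature.RingTheory.Length.mapsTo_torsionBy
            (X : PowerSeries A) e.symm.toLinearMap)).restrictScalars A)
          (Literature.RingTheory.Length.restrict_torsionBy_injective _ _ e.symm.injective) 𝔮)
    rw [h1, h2, charIdeal_eq_of_linearEquiv e]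
    exact lengthAt_cyclic 𝔭 h0 hX 𝔮 h𝔮
  · -- short exact sequences
    intro N₁ _ _ _ N₂ _ _ _ N₃ _ _ _ f g hf hg hfg ih₁ ih₃ _ _ hs 𝔮 h𝔮
    obtain ⟨s, hs0, hs⟩ := hs
    -- the `A`-structures on `N₁`, `N₃` by restriction along `A → A⟦X⟧`
    letI : Module A N₁ := Module.compHom N₁ (algebraMap A (PowerSeries A))
    haveI : IsScalarTower A (PowerSeries A) N₁ := IsScalarTower.of_algebraMap_smul fun _ _ => rfl
    letI : Module A N₃ := Module.compHom N₃ (algebraMap A (PowerSeries A))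
    haveI : IsScalarTower A (PowerSeries A) N₃ := IsScalarTower.of_algebraMap_smul fun _ _ => rfl
    have hs₁ : ∀ m : N₁, s • m = 0 := fun m => hf (by rw [map_smul, hs, map_zero])
    have hs₃ : ∀ m : N₃, s • m = 0 := fun m => by
      obtain ⟨n, rfl⟩ := hg m; rw [← map_smul, hs, map_zero]
    have e₁ := ih₁ ⟨s, hs0, hs₁⟩ 𝔮 h𝔮
    have e₃ := ih₃ ⟨s, hs0, hs₃⟩ 𝔮 h𝔮
    have hsnake := lengthAt_smul_snake (A := A) (X : PowerSeries A) f g hf hg hfg 𝔮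
    have hr := lengthAt_quotient_map_charIdeal_eq_add (A := A) f g hf hg hfg hs0 hs 𝔮
    -- finiteness of the four outer lengths
    haveI : IsNoetherian (PowerSeries A) N₂ := isNoetherian_of_isNoetherianRing_of_finite _ _
    haveI : Module.Finite A (QuotSMulTop (X : PowerSeries A) N₁) := moduleFinite_quotSMulTop
    haveI : Module.Finite A (QuotSMulTop (X : PowerSeries A) N₃) := moduleFinite_quotSMulTop
    haveI : Module.Finite A (Submodule.torsionBy (PowerSeries A) N₁ (X : PowerSeries A)) :=
      moduleFinite_torsionBy
    haveI : Module.Finite A (Submodule.torsionBy (PowerSeries A) N₃ (X : PowerSeries A)) :=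
      moduleFinite_torsionBy
    have hq1 : 𝔮.asIdeal.height ≤ 1 := le_of_eq h𝔮
    have fK₁ := lengthAt_ne_top_of_isTorsionBy hs0 (isTorsionBy_constantCoeff hs₁).2 𝔮 hq1
    have fK₃ := lengthAt_ne_top_of_isTorsionBy hs0 (isTorsionBy_constantCoeff hs₃).2 𝔮 hq1
    have fC₁ := lengthAt_ne_top_of_isTorsionBy hs0 (isTorsionBy_constantCoeff hs₁).1 𝔮 hq1
    have fC₃ := lengthAt_ne_top_of_isTorsionBy hs0 (isTorsionBy_constantCoeff hs₃).1 𝔮 hq1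
    -- bookkeeping in `ℕ∞`
    generalize lengthAt A (QuotSMulTop (X : PowerSeries A) N₁) 𝔮 = c₁ at *
    generalize lengthAt A (QuotSMulTop (X : PowerSeries A) N₂) 𝔮 = c₂ at *
    generalize lengthAt A (QuotSMulTop (X : PowerSeries A) N₃) 𝔮 = c₃ at *
    generalize lengthAt A (Submodule.torsionBy (PowerSeries A) N₁ (X : PowerSeries A)) 𝔮 = k₁ at *
    generalize lengthAt A (Submodule.torsionBy (PowerSeries A) N₂ (X : PowerSeries A)) 𝔮 = k₂ at *
    generalize lengthAt A (Submodule.torsionBy (PowerSeries A) N₃ (X : PowerSeries A)) 𝔮 = k₃ at *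
    generalize lengthAt A (A ⧸ (charIdeal (PowerSeries A) N₁).map
      (PowerSeries.constantCoeff (R := A))) 𝔮 = r₁ at *
    generalize lengthAt A (A ⧸ (charIdeal (PowerSeries A) N₂).map
      (PowerSeries.constantCoeff (R := A))) 𝔮 = r₂ at *
    generalize lengthAt A (A ⧸ (charIdeal (PowerSeries A) N₃).map
      (PowerSeries.constantCoeff (R := A))) 𝔮 = r₃ at *
    lift k₁ to ℕ using fK₁
    lift k₃ to ℕ using fK₃
    lift c₁ to ℕ using fC₁
    lift c₃ to ℕ using fC₃
    have fr₁ : r₁ ≠ ⊤ := by rintro rfl; simp at e₁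
    have fr₃ : r₃ ≠ ⊤ := by rintro rfl; simp at e₃
    lift r₁ to ℕ using fr₁
    lift r₃ to ℕ using fr₃
    have ec₁ : c₁ = k₁ + r₁ := by exact_mod_cast e₁
    have ec₃ : c₃ = k₃ + r₃ := by exact_mod_cast e₃
    subst ec₁ ec₃ hr
    induction c₂ using ENat.recTopCoe with
    | top =>
      rw [add_top] at hsnake
      have hk₂ : k₂ = ⊤ := by
        induction k₂ using ENat.recTopCoe with
        | top => rfl
        | coe k₂ => exact absurd hsnake (by exact_mod_cast ENat.coe_ne_top _)
      rw [hk₂, top_add]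
    | coe c₂ =>
      have fk₂ : k₂ ≠ ⊤ := by
        rintro rfl
        rw [top_add, top_add] at hsnake
        exact absurd hsnake.symm (by exact_mod_cast ENat.coe_ne_top _)
      lift k₂ to ℕ using fk₂
      have h : k₂ + (k₁ + r₁) + (k₃ + r₃) = k₁ + k₃ + c₂ := by exact_mod_cast hsnake
      have : c₂ = k₂ + (r₁ + r₃) := by omega
      exact_mod_cast this

end Devissage

/-! ### The Herbrand formula for characteristic ideals under `X ↦ 0` -/

section Herbrand

variable [IsDomain A] [IsNoetherianRing A] [UniqueFactorizationMonoid A]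
  [UniqueFactorizationMonoid (PowerSeries A)]

/-- **Specialisation `X ↦ 0` of characteristic ideals (Herbrand form).** Let `A` be a factorial
Noetherian domain with `A⟦X⟧` factorial, and `N` a finitely generated `A⟦X⟧`-module killed by some
`s` with `s(0) ≠ 0` (i.e. torsion with `(X) ∉ Supp N`), viewed as an `A`-module along `A → A⟦X⟧`.
Then `char_A(N/XN) = char_A(N[X]) · char_{A⟦X⟧}(N)(0)` as ideals of `A`, where `char(N)(0)` is the
image under `X ↦ 0` of the characteristic ideal (principal, generator with nonzero constant term).
(Bourbaki AC VII §4.5; for `A = ℤ_p⟦T⟧` this is the two-variable-to-one-variable specialisation of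
Iwasawa theory, e.g. Delbourgo 2008 Lemma 10.5, Ochiai 2006 Lemma 7.2, Skinner–Urban 2014
Cor. 3.2.9.) [folklore] -/
theorem charIdeal_quotSMulTop_eq_mul (N : Type v) [AddCommGroup N] [Module (PowerSeries A) N]
    [Module.Finite (PowerSeries A) N] [Module A N] [IsScalarTower A (PowerSeries A) N]
    (hs : ∃ s : PowerSeries A, PowerSeries.constantCoeff s ≠ 0 ∧ ∀ m : N, s • m = 0) :
    charIdeal A (QuotSMulTop (X : PowerSeries A) N) =
      charIdeal A (Submodule.torsionBy (PowerSeries A) N (X : PowerSeries A)) *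
        (charIdeal (PowerSeries A) N).map (PowerSeries.constantCoeff (R := A)) := by
  have hdev := lengthAt_quotSMulTop_eq_add (A := A) N ‹_› hs
  obtain ⟨s, hs0, hs⟩ := hs
  obtain ⟨F, hF, hF0⟩ := exists_charIdeal_eq_span (N := N) hs0 hs
  have hmap : (charIdeal (PowerSeries A) N).map (PowerSeries.constantCoeff (R := A)) =
      Ideal.span {PowerSeries.constantCoeff F} := by rw [hF, Ideal.map_span, Set.image_singleton]
  rw [hmap, ← Summit.BirchSwinnertonDyer.Rank1Residual.X11b.CongruenceLimit.charIdeal_quotient_span_singleton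
    (R := A) hF0]
  haveI : IsNoetherian (PowerSeries A) N := isNoetherian_of_isNoetherianRing_of_finite _ _
  have hK := (isTorsionBy_constantCoeff (A := A) hs).2
  have hC := (isTorsionBy_constantCoeff (A := A) hs).1
  have hQ : Module.IsTorsionBy A (A ⧸ Ideal.span {PowerSeries.constantCoeff F})
      (PowerSeries.constantCoeff F) := fun x => by
    obtain ⟨a, rfl⟩ := Ideal.Quotient.mk_surjective x
    change Ideal.Quotient.mk _ (PowerSeries.constantCoeff F * a) = 0
    rw [Ideal.Quotient.eq_zero_iff_mem]
    exact Ideal.mul_mem_right _ _ (Ideal.mem_span_singleton_self _)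
  haveI : Module.Finite A (QuotSMulTop (X : PowerSeries A) N) := moduleFinite_quotSMulTop
  haveI : Module.Finite A (Submodule.torsionBy (PowerSeries A) N (X : PowerSeries A)) :=
    moduleFinite_torsionBy
  unfold charIdeal
  rw [← finprod_mem_mul_distrib' (finite_heightOne_inter_mulSupport hs0 hK)
    (finite_heightOne_inter_mulSupport hF0 hQ)]
  refine finprod_mem_congr rfl fun 𝔮 h𝔮 => ?_
  rw [← pow_add, hdev 𝔮 h𝔮, lengthAt_quotient_congr hmap,
    ENat.toNat_add (lengthAt_ne_top_of_isTorsionBy hs0 hK 𝔮 (le_of_eq h𝔮))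
      (lengthAt_ne_top_of_isTorsionBy hF0 hQ 𝔮 (le_of_eq h𝔮))]

/-- The case `N[X] = 0`: `char_A(N/XN) = char_{A⟦X⟧}(N)(0)`. [folklore] -/
theorem charIdeal_quotSMulTop_eq_map (N : Type v) [AddCommGroup N] [Module (PowerSeries A) N]
    [Module.Finite (PowerSeries A) N] [Module A N] [IsScalarTower A (PowerSeries A) N]
    (hs : ∃ s : PowerSeries A, PowerSeries.constantCoeff s ≠ 0 ∧ ∀ m : N, s • m = 0)
    (hX : ∀ m : N, (X : PowerSeries A) • m = 0 → m = 0) :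
    charIdeal A (QuotSMulTop (X : PowerSeries A) N) =
      (charIdeal (PowerSeries A) N).map (PowerSeries.constantCoeff (R := A)) := by
  have hK : Submodule.torsionBy (PowerSeries A) N (X : PowerSeries A) = ⊥ :=
    eq_bot_iff.mpr fun m hm =>
      (Submodule.mem_bot _).mpr (hX m ((Submodule.mem_torsionBy_iff _ _).mp hm))
  haveI : Subsingleton (Submodule.torsionBy (PowerSeries A) N (X : PowerSeries A)) := by
    rw [hK]; infer_instance
  rw [charIdeal_quotSMulTop_eq_mul N hs, charIdeal_eq_one_of_subsingleton, one_mul]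

omit [IsNoetherianRing A] [UniqueFactorizationMonoid A] [UniqueFactorizationMonoid (PowerSeries A)] in
/-- From "`N/XN` is `A`-torsion" to "some `s` with `s(0) ≠ 0` kills `N`" for a finitely generated
`A⟦X⟧`-module `N` (determinant trick, `lengthAt_eq_zero_of_forall_exists_notMem`). [folklore] -/
theorem exists_constantCoeff_ne_zero_smul_eq_zero (N : Type v) [AddCommGroup N]
    [Module (PowerSeries A) N] [Module.Finite (PowerSeries A) N] [Module A N]
    [IsScalarTower A (PowerSeries A) N]
    (hq : Module.IsTorsion A (N ⧸ (Ideal.span {(X : PowerSeries A)} •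
      (⊤ : Submodule (PowerSeries A) N)))) :
    ∃ s : PowerSeries A, PowerSeries.constantCoeff s ≠ 0 ∧ ∀ m : N, s • m = 0 := by
  let PX : PrimeSpectrum (PowerSeries A) := ⟨Ideal.span {X}, PowerSeries.span_X_isPrime⟩
  have h0 : lengthAt (PowerSeries A) N PX = 0 := by
    refine lengthAt_eq_zero_of_forall_exists_notMem PX fun m => ?_
    obtain ⟨a, ha⟩ := @hq (Submodule.Quotient.mk m)
    refine ⟨algebraMap A (PowerSeries A) a, fun h => ?_, ?_⟩
    · exact nonZeroDivisors.coe_ne_zero a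
        (by rw [← constantCoeff_algebraMap (A := A) (a : A)]; exact mem_span_X_iff.mp h)
    · have h : Submodule.Quotient.mk (p := (Ideal.span {(X : PowerSeries A)} •
          (⊤ : Submodule (PowerSeries A) N))) ((a : A) • m) = 0 := by
        rw [Submodule.Quotient.mk_smul]; exact ha
      rw [Submodule.Quotient.mk_eq_zero] at h
      rwa [algebraMap_smul]
  obtain ⟨s, hsX, hs⟩ := exists_notMem_forall_smul_eq_zero_of_lengthAt_eq_zero h0
  exact ⟨s, fun h => hsX (mem_span_X_iff.mpr h), hs⟩

end Herbrand

end PowerSeriesSpecialization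

/-! ### The two-variable Iwasawa algebra `Λ₂ = ℤ_p⟦T₂⟧⟦T₁⟧ → Λ₁ = ℤ_p⟦T₂⟧`, `T₁ ↦ 0` -/

namespace TwoVar

open LocalLength PowerSeriesSpecialization

/-- **Specialisation `T₁ ↦ 0` for `Λ₂ = ℤ_p⟦T₂⟧⟦T₁⟧`-modules** (the algebra of Delbourgo 2008,
Ch. X Lemma 10.5 in the case `r = 0`, `M[Y] = 0`; Ochiai 2006 Lemma 7.2; Skinner–Urban 2014
Cor. 3.2.9 (ii)). For a finitely generated `Λ₂`-module `M` on which `T₁ = X` is injective and which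
is killed by some `s` with `s(0) ≠ 0` (⟺ `M` torsion with `M/T₁M` torsion over `Λ₁`), the image of
`ch_{Λ₂}(M)` under `T₁ ↦ 0` is `ch_{Λ₁}(M/T₁M)`, where `M/T₁M` carries the `Λ₁ = ℤ_p⟦T₂⟧`-structure
**restricted along the constants `PowerSeries.C : Λ₁ → Λ₂`** (so that `T ∈ Λ₁` acts as
`T₂ = C T`); this structure is written `letI` into the statement to pin it, because Mathlib's
default instance `PowerSeries.algebraPowerSeries : Algebra Λ₁ Λ₂` is the DIFFERENT map `T ↦ T₁`.
PROVED: `Λ₁` is factorial (Mathlib), `Λ₂` is factorial (tree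
`IwasawaTheory.uniqueFactorizationMonoid_iwasawaAlgebraTwoVar`, Auslander–Buchsbaum), and
`PowerSeriesSpecialization.charIdeal_quotSMulTop_eq_map`. [cite: Delbourgo2008, Ch. X Lemma 10.5] -/
theorem map_constantCoeff_charIdeal_eq (p : ℕ) [Fact p.Prime] (M : Type*) [AddCommGroup M]
    [Module (PowerSeries (IwasawaAlgebra p)) M] [Module.Finite (PowerSeries (IwasawaAlgebra p)) M]
    (hs : ∃ s : PowerSeries (IwasawaAlgebra p),
      PowerSeries.constantCoeff s ≠ 0 ∧ ∀ m : M, s • m = 0)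
    (hX : ∀ m : M, (PowerSeries.X : PowerSeries (IwasawaAlgebra p)) • m = 0 → m = 0) :
    letI : Module (IwasawaAlgebra p)
        (QuotSMulTop (PowerSeries.X : PowerSeries (IwasawaAlgebra p)) M) :=
      Module.compHom _ (PowerSeries.C (R := IwasawaAlgebra p))
    (charIdeal (PowerSeries (IwasawaAlgebra p)) M).map
        (PowerSeries.constantCoeff (R := IwasawaAlgebra p)) =
      charIdeal (IwasawaAlgebra p) (QuotSMulTop (PowerSeries.X : PowerSeries (IwasawaAlgebra p)) M) := by
  haveI : UniqueFactorizationMonoid (PowerSeries (IwasawaAlgebra p)) :=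
    Literature.NumberTheory.IwasawaTheory.uniqueFactorizationMonoid_iwasawaAlgebraTwoVar p
  -- the constants algebra `C : Λ₁ → Λ₂` (NOT Mathlib's default `algebraPowerSeries`, `T ↦ T₁`)
  let alg : Algebra (IwasawaAlgebra p) (PowerSeries (IwasawaAlgebra p)) :=
    @MvPowerSeries.instAlgebra Unit (IwasawaAlgebra p) (IwasawaAlgebra p) _ _ (Algebra.id _)
  letI : Module (IwasawaAlgebra p) M := Module.compHom M (PowerSeries.C (R := IwasawaAlgebra p))
  have hIST : @IsScalarTower (IwasawaAlgebra p) (PowerSeries (IwasawaAlgebra p)) M alg.toSMul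
      inferInstance inferInstance :=
    @IsScalarTower.mk _ _ _ alg.toSMul _ _ fun a r m => by
      rw [@Algebra.smul_def _ _ _ _ alg a r, mul_smul]
      rfl
  exact (@charIdeal_quotSMulTop_eq_map (IwasawaAlgebra p) _ _ _ _ _ M _ _ _ _ hIST hs hX).symm

/-- The same with the hypothesis in the form "`M/T₁M` is torsion over `Λ₁`" (for the constants
structure; determinant trick, `exists_constantCoeff_ne_zero_smul_eq_zero`).
[cite: Delbourgo2008, Ch. X Lemma 10.5] -/
theorem map_constantCoeff_charIdeal_eq_of_isTorsion (p : ℕ) [Fact p.Prime] (M : Type*)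
    [AddCommGroup M] [Module (PowerSeries (IwasawaAlgebra p)) M]
    [Module.Finite (PowerSeries (IwasawaAlgebra p)) M]
    (hX : ∀ m : M, (PowerSeries.X : PowerSeries (IwasawaAlgebra p)) • m = 0 → m = 0)
    (hq : letI : Module (IwasawaAlgebra p)
              (QuotSMulTop (PowerSeries.X : PowerSeries (IwasawaAlgebra p)) M) :=
            Module.compHom _ (PowerSeries.C (R := IwasawaAlgebra p))
          Module.IsTorsion (IwasawaAlgebra p)
            (QuotSMulTop (PowerSeries.X : PowerSeries (IwasawaAlgebra p)) M)) :
    letI : Module (IwasawaAlgebra p)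
        (QuotSMulTop (PowerSeries.X : PowerSeries (IwasawaAlgebra p)) M) :=
      Module.compHom _ (PowerSeries.C (R := IwasawaAlgebra p))
    (charIdeal (PowerSeries (IwasawaAlgebra p)) M).map
        (PowerSeries.constantCoeff (R := IwasawaAlgebra p)) =
      charIdeal (IwasawaAlgebra p) (QuotSMulTop (PowerSeries.X : PowerSeries (IwasawaAlgebra p)) M) := by
  refine map_constantCoeff_charIdeal_eq p M ?_ hX
  let alg : Algebra (IwasawaAlgebra p) (PowerSeries (IwasawaAlgebra p)) :=
    @MvPowerSeries.instAlgebra Unit (IwasawaAlgebra p) (IwasawaAlgebra p) _ _ (Algebra.id _)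
  letI : Module (IwasawaAlgebra p) M := Module.compHom M (PowerSeries.C (R := IwasawaAlgebra p))
  have hIST : @IsScalarTower (IwasawaAlgebra p) (PowerSeries (IwasawaAlgebra p)) M alg.toSMul
      inferInstance inferInstance :=
    @IsScalarTower.mk _ _ _ alg.toSMul _ _ fun a r m => by
      rw [@Algebra.smul_def _ _ _ _ alg a r, mul_smul]
      rfl
  refine @exists_constantCoeff_ne_zero_smul_eq_zero (IwasawaAlgebra p) _ _ M _ _ _ _ hIST ?_
  rw [Submodule.ideal_span_singleton_smul]
  exact hq

end TwoVar

end Summit.BirchSwinnertonDyer.BirchSwinnertonDyer.Theorems.SignedBaseChangeAcDivSpecialization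

end
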